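import Literature.AlgebraicGeometry.Resolution.AlterationsMultisectionEtaleNhdChart
import Literature.AlgebraicGeometry.Resolution.FibreStalkDVR
import Literature.AlgebraicGeometry.Resolution.AffineChartFibres
import Literature.AlgebraicGeometry.Motives.FiberStalk
import Mathlib.RingTheory.Localization.Ideal
import Mathlib.RingTheory.DiscreteValuationRing.Basic
import HarnessLib

/-!
# The affine ring of a fibre on a chart: local rings at smooth closed points

Topic: `Literature/AlgebraicGeometry/Resolution`. Let `f : X → Y` be a morphism, `W = Spec A ⊆ X`
and `U = Spec B ⊆ Y` affine opens with `f(W) ⊆ U`, `y ∈ U` a closed point with maximal ideal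
`𝔫 ⊆ B`, and `F = A/𝔫A` the affine ring of `f⁻¹(y) ∩ W`. This file identifies the local rings
of `F` with the local rings of the scheme-theoretic fibre `X_y`:

* `nonempty_stalkFiber_ringEquiv_locQuot` — `𝒪_{X_y, x} ≅ A_𝔭 / 𝔫A_𝔭` for the point `x` of
  `W` with prime `𝔭` (Liu, Ch. 4, proof of Thm. 3.36, through the tree's
  `Motives.nonempty_stalkFiber_ringEquiv_asFiber` and `nonempty_stalkQuot_ringEquiv_of_chart`);
* `isLocalization_atPrime_locQuot` — `A_𝔭 / IA_𝔭` is the localisation of `A/I` at `𝔭/I`;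
* `exists_isDiscreteValuationRing_of_ringEquiv` — being a discrete valuation ring is invariant
  under ring isomorphisms;
* **`isDiscreteValuationRing_localization_fibreRing`** — if `f` is locally of finite
  presentation with all irreducible components of all fibres of dimension `1`, then at every
  maximal ideal of `F` whose point lies in `sm(f)` the local ring of `F` is a discrete valuation
  ring (de Jong 1996, proof of 4.13: "`(f⁻¹(y) ∩ sm(X/Y))_red`" is a smooth curve).

## References

* A. J. de Jong, *Smoothness, semi-stability and alterations*, Publ. Math. IHÉS 83 (1996),
  Lemma 4.13 (proof), p. 70. [DeJong1996]
* Q. Liu, *Algebraic Geometry and Arithmetic Curves* (2002), Ch. 4, proof of Thm. 3.36.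
-/

noncomputable section

universe u

open CategoryTheory AlgebraicGeometry Order Topology TopologicalSpace IsLocalRing

namespace Literature.AlgebraicGeometry.Resolution

/-! ### Algebra: quotients of localisations; transport of the DVR property -/

section Algebra

variable {A : Type u} [CommRing A]

/-- The prime `𝔭/I` of `A/I` is prime (for `I ⊆ 𝔭`). [folklore] -/
theorem isPrime_map_quotient_mk {I : Ideal A} (p : Ideal A) [p.IsPrime] (hIp : I ≤ p) :
    (p.map (Ideal.Quotient.mk I)).IsPrime :=
  Ideal.map_isPrime_of_surjective Ideal.Quotient.mk_surjective (by rw [Ideal.mk_ker]; exact hIp)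

/-- For `I ⊆ 𝔭`, the image of `A ∖ 𝔭` in `A/I` is the complement of the prime `𝔭/I`.
[folklore] -/
theorem algebraMapSubmonoid_quotient_primeCompl {I : Ideal A} (p : Ideal A) [p.IsPrime]
    (hIp : I ≤ p) [(p.map (Ideal.Quotient.mk I)).IsPrime] :
    Algebra.algebraMapSubmonoid (A ⧸ I) p.primeCompl =
      (p.map (Ideal.Quotient.mk I)).primeCompl := by
  ext x
  rw [Algebra.algebraMapSubmonoid, Submonoid.mem_map]
  constructor
  · rintro ⟨a, ha, rfl⟩
    change algebraMap A (A ⧸ I) a ∉ p.map (Ideal.Quotient.mk I)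
    rw [Ideal.Quotient.algebraMap_eq, Ideal.mem_quotient_iff_mem_sup, sup_eq_left.mpr hIp]
    exact ha
  · intro hx
    change x ∉ p.map (Ideal.Quotient.mk I) at hx
    obtain ⟨a, rfl⟩ := Ideal.Quotient.mk_surjective x
    exact ⟨a, fun ha => hx (Ideal.mem_map_of_mem _ ha), rfl⟩

/-- **`A_𝔭 / I A_𝔭` is the localisation of `A/I` at `𝔭/I`** (`I ⊆ 𝔭`; quotients commute with
localisation, Mathlib `IsLocalization (algebraMapSubmonoid (A/I) M) (S/IS)`). [folklore] -/
theorem isLocalization_atPrime_locQuot {I : Ideal A} (p : Ideal A) [p.IsPrime] (hIp : I ≤ p)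
    [(p.map (Ideal.Quotient.mk I)).IsPrime] :
    IsLocalization.AtPrime (Localization.AtPrime p ⧸ I.map (algebraMap A (Localization.AtPrime p)))
      (p.map (Ideal.Quotient.mk I)) := by
  have h := algebraMapSubmonoid_quotient_primeCompl p hIp
  have inst : IsLocalization (Algebra.algebraMapSubmonoid (A ⧸ I) p.primeCompl)
      (Localization.AtPrime p ⧸ I.map (algebraMap A (Localization.AtPrime p))) := inferInstance
  rwa [h] at inst

/-- A prime of `A/I` is the image of its preimage in `A`. [folklore] -/
theorem map_comap_quotient_mk {I : Ideal A} (q : Ideal (A ⧸ I)) :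
    (q.comap (Ideal.Quotient.mk I)).map (Ideal.Quotient.mk I) = q :=
  Ideal.map_comap_of_surjective _ Ideal.Quotient.mk_surjective q

/-- **Being a discrete valuation ring is invariant under ring isomorphisms.** [folklore] -/
theorem exists_isDiscreteValuationRing_of_ringEquiv {R S : Type*} [CommRing R] [CommRing S]
    (h : ∃ _ : IsDomain R, IsDiscreteValuationRing R) (e : R ≃+* S) :
    ∃ _ : IsDomain S, IsDiscreteValuationRing S := by
  obtain ⟨hdom, hdvr⟩ := h
  haveI : IsDomain S := MulEquiv.isDomain R e.symm.toMulEquiv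
  haveI : IsLocalRing S := e.isLocalRing
  haveI : IsPrincipalIdealRing S := IsPrincipalIdealRing.of_surjective e.toRingHom e.surjective
  refine ⟨inferInstance, { not_a_field' := ?_ }⟩
  intro hbot
  apply hdvr.not_a_field'
  rw [← map_ringEquiv_maximalIdeal e] at hbot
  exact (Ideal.map_eq_bot_iff_of_injective e.injective).mp hbot

end Algebra

/-! ### Closed points of an affine open and maximal ideals -/

/-- In a Jacobson scheme, the point of a maximal ideal of an affine open `U` is a closed point
(it is closed in `U`, i.e. locally closed). [folklore] -/
theorem isClosed_singleton_fromSpec_of_isMaximal {X : Scheme.{u}} [JacobsonSpace X] {U : X.Opens}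
    (hU : IsAffineOpen U) (𝔫 : PrimeSpectrum Γ(X, U)) (h𝔫 : 𝔫.asIdeal.IsMaximal) :
    IsClosed ({hU.fromSpec 𝔫} : Set X) := by
  apply isClosed_singleton_of_isLocallyClosed_singleton
  have hcl : IsClosed ({𝔫} : Set (PrimeSpectrum Γ(X, U))) :=
    (PrimeSpectrum.isClosed_singleton_iff_isMaximal 𝔫).mpr h𝔫
  have hemb := hU.fromSpec.isOpenEmbedding
  refine ⟨Set.range hU.fromSpec, (hU.fromSpec '' ({𝔫}ᶜ : Set _))ᶜ, hemb.isOpen_range,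
    (hemb.isOpenMap _ hcl.isOpen_compl).isClosed_compl, ?_⟩
  ext z
  simp only [Set.mem_singleton_iff, Set.mem_inter_iff, Set.mem_range, Set.mem_compl_iff,
    Set.mem_image, not_exists, not_and]
  constructor
  · rintro rfl
    exact ⟨⟨𝔫, rfl⟩, fun q hq he => hq (hemb.injective he)⟩
  · rintro ⟨⟨q, rfl⟩, h⟩
    by_contra hne
    exact h q (fun hq => hne (by rw [hq])) rfl

/-! ### The local rings of the fibre ring `A/𝔫A` -/

section Chart

variable {X Y : Scheme.{u}} (f : X ⟶ Y) {U : Y.Opens} (hU : IsAffineOpen U) {W : X.Opens}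
  (hW : IsAffineOpen W) (hWU : W ≤ f ⁻¹ᵁ U)

/-- **The ideal `𝔫A ⊆ A = Γ(W)` of the fibre `f⁻¹(y) ∩ W`**: the extension of the prime `𝔫 ⊆ Γ(U)`
of the point `y ∈ U` along `f^♯ : Γ(U) → Γ(W)`; `A/𝔫A` is the affine ring of `X_y ∩ W` for `y`
closed. [folklore] -/
abbrev fibreIdeal {y : Y} (hyU : y ∈ U) : Ideal Γ(X, W) :=
  (hU.primeIdealOf ⟨y, hyU⟩).asIdeal.map (f.appLE U W hWU).hom

/-- **`𝒪_{X_{f x}, x} ≅ A_𝔭 / 𝔫 A_𝔭`** for the point `x` of the affine open `W = Spec A` with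
prime `𝔭`, `f(W) ⊆ U = Spec B`, `𝔫 ⊆ B` the prime of `f x` (Liu, Ch. 4, proof of Thm. 3.36).
[folklore] -/
theorem nonempty_stalkFiber_ringEquiv_locQuot (p : PrimeSpectrum Γ(X, W)) :
    Nonempty (((f.fiber (f (hW.fromSpec p))).presheaf.stalk (f.asFiber (hW.fromSpec p))) ≃+*
      (Localization.AtPrime p.asIdeal ⧸
        ((hU.primeIdealOf ⟨f (hW.fromSpec p), hWU (fromSpec_mem hW p)⟩).asIdeal.map
          (f.appLE U W hWU).hom).map (algebraMap Γ(X, W) (Localization.AtPrime p.asIdeal)))) := by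
  obtain ⟨e₁⟩ := Literature.AlgebraicGeometry.Motives.nonempty_stalkFiber_ringEquiv_asFiber f
    (hW.fromSpec p)
  have hc : hW.fromSpec ≫ f = Spec.map (f.appLE U W hWU) ≫ hU.fromSpec :=
    (IsAffineOpen.SpecMap_appLE_fromSpec f hU hW hWU).symm
  obtain ⟨e₂⟩ := nonempty_stalkQuot_ringEquiv_of_chart hU (f.appLE U W hWU) hW.fromSpec f p hc
  refine ⟨e₁.trans (e₂.trans (Ideal.quotEquivOfEq ?_))⟩
  rw [← Ideal.map_map]
  congr 2
  have key := IsAffineOpen.comap_primeIdealOf_appLE U hU W hW hWU (fromSpec_mem hW p)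
  rw [primeIdealOf_fromSpec] at key
  exact congrArg PrimeSpectrum.asIdeal key

variable [LocallyOfFinitePresentation f] [JacobsonSpace X]

/-- **The local rings of the fibre ring at smooth closed points are discrete valuation rings.**
Let `f` be locally of finite presentation with all irreducible components of all fibres of
dimension `1`, `y ∈ U` a closed point with maximal ideal `𝔫`, and `𝔭 ⊇ 𝔫A` a maximal ideal of
`A = Γ(W)` whose point lies in `sm(f)`. Then the localisation of `A/𝔫A` at `𝔭/𝔫A` is a discrete
valuation ring: it is `A_𝔭/𝔫A_𝔭 ≅ 𝒪_{X_y, x}`, the local ring of the fibre at a smooth closed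
point (`isDiscreteValuationRing_stalk_fiber`). [cite: DeJong1996, Lemma 4.13 (proof), p. 70] -/
theorem isDiscreteValuationRing_localization_fibreRing
    (hdim : ∀ (y : Y), ∀ C ∈ irreducibleComponents ↥(f.fiber y), topologicalKrullDim ↥C = 1)
    {y : Y} (hyU : y ∈ U) (hy : IsClosed ({y} : Set Y)) (p : PrimeSpectrum Γ(X, W))
    (hpmax : p.asIdeal.IsMaximal)
    (hp : (hU.primeIdealOf ⟨y, hyU⟩).asIdeal.map (f.appLE U W hWU).hom ≤ p.asIdeal)
    (hsm : hW.fromSpec p ∈ f.smoothLocus)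
    [(p.asIdeal.map (Ideal.Quotient.mk
      ((hU.primeIdealOf ⟨y, hyU⟩).asIdeal.map (f.appLE U W hWU).hom))).IsPrime] :
    ∃ _ : IsDomain (Localization.AtPrime (p.asIdeal.map (Ideal.Quotient.mk
        ((hU.primeIdealOf ⟨y, hyU⟩).asIdeal.map (f.appLE U W hWU).hom)))),
      IsDiscreteValuationRing (Localization.AtPrime (p.asIdeal.map (Ideal.Quotient.mk
        ((hU.primeIdealOf ⟨y, hyU⟩).asIdeal.map (f.appLE U W hWU).hom)))) := by
  set 𝔫A := (hU.primeIdealOf ⟨y, hyU⟩).asIdeal.map (f.appLE U W hWU).hom with h𝔫A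
  set x := hW.fromSpec p with hxdef
  have hymax := isMaximal_primeIdealOf_of_isClosed hU hyU hy
  have hfx : f x = y := (apply_fromSpec_eq_iff_map_le f hU hW hWU ⟨y, hyU⟩ hymax p).mpr hp
  have hxcl : IsClosed ({x} : Set X) := isClosed_singleton_fromSpec_of_isMaximal hW p hpmax
  -- the local ring of the fibre at `x` is a DVR
  have h1 := isDiscreteValuationRing_stalk_fiber f hdim hxcl hsm
  -- `≅ A_𝔭 / 𝔫A_𝔭`
  obtain ⟨e⟩ := nonempty_stalkFiber_ringEquiv_locQuot f hU hW hWU p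
  have h𝔫eq : (hU.primeIdealOf ⟨f (hW.fromSpec p), hWU (fromSpec_mem hW p)⟩).asIdeal.map
      (f.appLE U W hWU).hom = 𝔫A := by
    rw [h𝔫A]
    congr 3
    exact Subtype.ext hfx
  have h2 := exists_isDiscreteValuationRing_of_ringEquiv h1 (e.trans (Ideal.quotEquivOfEq
    (congrArg (Ideal.map (algebraMap Γ(X, W) (Localization.AtPrime p.asIdeal))) h𝔫eq)))
  -- `≅ (A/𝔫A)_{𝔭/𝔫A}`
  haveI := isLocalization_atPrime_locQuot (I := 𝔫A) p.asIdeal hp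
  exact exists_isDiscreteValuationRing_of_ringEquiv h2
    (IsLocalization.algEquiv (p.asIdeal.map (Ideal.Quotient.mk 𝔫A)).primeCompl
      (Localization.AtPrime p.asIdeal ⧸ 𝔫A.map (algebraMap Γ(X, W) (Localization.AtPrime p.asIdeal)))
      (Localization.AtPrime (p.asIdeal.map (Ideal.Quotient.mk 𝔫A)))).toRingEquiv

/-- **The local rings of the fibre ring `A/𝔫A` at its maximal ideals are discrete valuation
rings** when all closed points of `f⁻¹(y) ∩ W` are smooth points of `f` (same hypotheses;
the maximal ideal `𝔪` of `A/𝔫A` is `𝔭/𝔫A` for `𝔭 = 𝔪 ∩ A`). [cite: DeJong1996, Lemma 4.13 (proof), p. 70] -/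
theorem isDiscreteValuationRing_localization_atMaximal_fibreRing
    (hdim : ∀ (y : Y), ∀ C ∈ irreducibleComponents ↥(f.fiber y), topologicalKrullDim ↥C = 1)
    {y : Y} (hyU : y ∈ U) (hy : IsClosed ({y} : Set Y))
    (hsm : ∀ p : PrimeSpectrum Γ(X, W), p.asIdeal.IsMaximal → fibreIdeal f hU hWU hyU ≤ p.asIdeal →
      hW.fromSpec p ∈ f.smoothLocus)
    (𝔪 : Ideal (Γ(X, W) ⧸ fibreIdeal f hU hWU hyU)) [h𝔪 : 𝔪.IsMaximal] :
    ∃ _ : IsDomain (Localization.AtPrime 𝔪), IsDiscreteValuationRing (Localization.AtPrime 𝔪) := by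
  let 𝔫A := fibreIdeal f hU hWU hyU
  let p : PrimeSpectrum Γ(X, W) := ⟨𝔪.comap (Ideal.Quotient.mk 𝔫A), Ideal.comap_isPrime _ 𝔪⟩
  have hpmax : p.asIdeal.IsMaximal := Ideal.comap_isMaximal_of_surjective _ Ideal.Quotient.mk_surjective
  have hp : 𝔫A ≤ p.asIdeal := by
    intro a ha
    change Ideal.Quotient.mk 𝔫A a ∈ 𝔪
    rw [Ideal.Quotient.eq_zero_iff_mem.mpr ha]
    exact zero_mem _
  have hmap : p.asIdeal.map (Ideal.Quotient.mk 𝔫A) = 𝔪 := map_comap_quotient_mk 𝔪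
  haveI hprime : (p.asIdeal.map (Ideal.Quotient.mk 𝔫A)).IsPrime := by rw [hmap]; infer_instance
  have h1 := isDiscreteValuationRing_localization_fibreRing f hU hW hWU hdim hyU hy p hpmax hp
    (hsm p hpmax hp)
  -- transport along `(A/𝔫A)_{𝔭/𝔫A} = (A/𝔫A)_𝔪`
  have hM : (p.asIdeal.map (Ideal.Quotient.mk 𝔫A)).primeCompl = 𝔪.primeCompl := by
    ext a
    change a ∉ p.asIdeal.map (Ideal.Quotient.mk 𝔫A) ↔ a ∉ 𝔪
    rw [hmap]
  haveI : IsLocalization.AtPrime (Localization.AtPrime 𝔪) (p.asIdeal.map (Ideal.Quotient.mk 𝔫A)) := by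
    change IsLocalization (p.asIdeal.map (Ideal.Quotient.mk 𝔫A)).primeCompl (Localization.AtPrime 𝔪)
    rw [hM]
    infer_instance
  exact exists_isDiscreteValuationRing_of_ringEquiv h1
    (IsLocalization.algEquiv (p.asIdeal.map (Ideal.Quotient.mk 𝔫A)).primeCompl
      (Localization.AtPrime (p.asIdeal.map (Ideal.Quotient.mk 𝔫A)))
      (Localization.AtPrime 𝔪)).toRingEquiv

omit [LocallyOfFinitePresentation f] [JacobsonSpace X] in
/-- A ring all of whose localisations at maximal ideals are discrete valuation rings has Krull
dimension `≤ 1`. [folklore] -/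
theorem ringKrullDim_le_one_of_forall_isMaximal_dvr {D : Type*} [CommRing D]
    (h : ∀ (𝔪 : Ideal D) [𝔪.IsMaximal],
      ∃ _ : IsDomain (Localization.AtPrime 𝔪), IsDiscreteValuationRing (Localization.AtPrime 𝔪)) :
    ringKrullDim D ≤ 1 := by
  rw [ringKrullDim_le_iff_isMaximal_height_le]
  intro 𝔪 h𝔪
  haveI := h𝔪
  obtain ⟨hdom, hdvr⟩ := h 𝔪
  rw [← IsLocalization.AtPrime.ringKrullDim_eq_height 𝔪 (Localization.AtPrime 𝔪)]
  have h1 : Ring.KrullDimLE 1 (Localization.AtPrime 𝔪) :=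
    Ring.KrullDimLE.mk₁' fun I hI hIp => hIp.isMaximal hI
  have h2 := (Ring.krullDimLE_iff (R := Localization.AtPrime 𝔪) (n := 1)).mp h1
  exact_mod_cast h2

end Chart

end Literature.AlgebraicGeometry.Resolution
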